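import Summits.AtomisticToContinuum.Crystallization.Theorems.OverbindingBudgetAffineFarFieldCellFacetsHCP
import Summits.AtomisticToContinuum.Crystallization.Theorems.OverbindingBudgetAffineFarFieldCollarKit

/-!
# Overbinding budget — far-field Voronoi cells, part 27V-T «CellFacetsRows»: dual rows of the facet frames

Route `OverbindingBudget`, crux `RobustDefectLimitWindows` (stmt-31280), line (2c), leaf SW♭(30), part 27V
(interface row, design (R*) «reference frontier»; lever L1 «dual rows» of the F3 price memo, critic r1759 (b)).
The tube lemma of «CollarKit» (`cthickening_image_subset`, T4a) thickens a prism `p + T(box)` ISOTROPICALLY by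
`u/a` in every frame coordinate, `a = √2·h` the lower row of the facet frame.  In the facet PLANE the frames are
longer than `a`: thickening coordinate `i` by `‖Rᵢ‖·u`, `Rᵢ` the DUAL ROWS of the frame (`⟪Rᵢ, T x⟫ = xᵢ`), is
enough and strictly smaller (`‖R₀‖ = ‖R₁‖ = √6/(4h) = (√3/2)/a` for the rhombi; `3√6/(16h)`, `√6/(4h)` for the
trapezoids' edge parallelograms; `‖R₂‖ = 1/a` along the normal).  At the star widths of record this lowers
every facet tube book by 4–8 %.

* §1 KIT (generic): `isCompact_coordBox_fin3`; ★ `cthickening_image_subset_rows` — the `u`-tube of `p + T(B)` lies in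
  `p + T({z | ∃ b ∈ B, |zᵢ - bᵢ| ≤ ‖Rᵢ‖u})`; for a coordinate box this is the box enlarged by `‖Rᵢ‖u`
  (`cthickening_image_box_subset_rows`), of volume `≤ |det T|·∏ (hᵢ - lᵢ + 2‖Rᵢ‖u)` (`volume_cthickening_image_box_le`).
* §2 rows under isometric transport and the coordinate pairing.
* §3 the dual rows of the base rhombus frame of «CellFacets» and of the equatorial frame `eqFrame` of
  «CellFacetsTRD», with their squared norms.
* §4 ★ the cap-in-prism packages of «CellFacets» / «CellFacetsHCP» RE-ISSUED WITH ROWS: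
  `rdCell_cap_subset_prism_rows` (`w ∈ fccInt`: `‖R‖² = (3/(8h²), 3/(8h²), 1/(2h²))`) and
  `trdCell_cap_subset_prism_rows` (`w ∈ hcpInt`, `ε < 1/3`: equatorial bonds `‖R₀‖² = 27/(128h²)`, else as the rhombi).
Pure analysis on `ℝ³`, atlas-free.
-/

namespace Summit.AtomisticToContinuum.Crystallization.Theorems.OverbindingBudgetAffineFarFieldCellFacetsRows

noncomputable section

open Set MeasureTheory Metric
open scoped Pointwise
open Literature.Geometry.DiscreteGeometry (intVec intVec_apply fccInt hcpInt)
open Summit.AtomisticToContinuum.Crystallization.Theorems.OverbindingBudgetAffineFarFieldCellRD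
open Summit.AtomisticToContinuum.Crystallization.Theorems.OverbindingBudgetAffineFarFieldCellSymm
open Summit.AtomisticToContinuum.Crystallization.Theorems.OverbindingBudgetAffineFarFieldCellTwist
open Summit.AtomisticToContinuum.Crystallization.Theorems.OverbindingBudgetAffineFarFieldCellTRD
open Summit.AtomisticToContinuum.Crystallization.Theorems.OverbindingBudgetAffineFarFieldCellTRDCubic
open Summit.AtomisticToContinuum.Crystallization.Theorems.OverbindingBudgetAffineFarFieldCellFacets
open Summit.AtomisticToContinuum.Crystallization.Theorems.OverbindingBudgetAffineFarFieldCellFacetsTRD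
open Summit.AtomisticToContinuum.Crystallization.Theorems.OverbindingBudgetAffineFarFieldCellFacetsHCP
open Summit.AtomisticToContinuum.Crystallization.Theorems.OverbindingBudgetAffineFarFieldCollarKit

local notation "E3" => EuclideanSpace ℝ (Fin 3)

/-! ## §1 Kit: per-coordinate thickening of a prism by the dual rows -/

/-- support (kit): a closed coordinate box of `E3` is compact. -/
theorem isCompact_coordBox_fin3 (l h : Fin 3 → ℝ) : IsCompact {x : E3 | ∀ i, l i ≤ x i ∧ x i ≤ h i} := by
  have e : {x : E3 | ∀ i, l i ≤ x i ∧ x i ≤ h i} = (EuclideanSpace.equiv (Fin 3) ℝ) ⁻¹' Icc l h := by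
    ext x
    simp only [mem_setOf_eq, mem_preimage, mem_Icc, Pi.le_def, ← forall_and]
    rfl
  rw [e]
  exact (EuclideanSpace.equiv (Fin 3) ℝ).toHomeomorph.isCompact_preimage.2 isCompact_Icc

/-- ★ support (kit, T4a with ROWS): if `R` are dual rows of the frame `T` (`⟪R i, T x⟫ = x i`) and `T` is
onto, the `u`-tube of the prism `p + T(B)` over a compact `B` lies in `p + T` of the set of points within
`‖R i‖·u` of `B` in each coordinate `i`. [this file] -/
theorem cthickening_image_subset_rows (T : E3 →L[ℝ] E3) (p : E3) (R : Fin 3 → E3)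
    (hR : ∀ x i, inner ℝ (R i) (T x) = x i) (hsurj : Function.Surjective T) {B : Set E3}
    (hB : IsCompact B) {u : ℝ} (hu : 0 ≤ u) :
    cthickening u ((fun x => p + T x) '' B) ⊆
      (fun x => p + T x) '' {z | ∃ b ∈ B, ∀ i, |z i - b i| ≤ ‖R i‖ * u} := by
  have hc : IsCompact ((fun x => p + T x) '' B) := hB.image (by fun_prop)
  rw [hc.cthickening_eq_biUnion_closedBall hu]
  intro x hx
  simp only [mem_iUnion, exists_prop] at hx
  obtain ⟨x₁, ⟨b, hb, rfl⟩, hx⟩ := hx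
  obtain ⟨e, he⟩ := hsurj (x - (p + T b))
  refine ⟨b + e, ⟨b, hb, fun i => ?_⟩, ?_⟩
  · have hi : (b + e) i - b i = inner ℝ (R i) (T e) := by rw [hR e i, PiLp.add_apply, add_sub_cancel_left]
    rw [hi]
    refine (abs_real_inner_le_norm _ _).trans (mul_le_mul_of_nonneg_left ?_ (norm_nonneg _))
    rw [he, ← dist_eq_norm]
    exact mem_closedBall.1 hx
  · simp only [map_add, he]; abel

/-- support (kit): box form — the `u`-tube of `p + T([l, h])` lies in `p + T([l - ‖R‖u, h + ‖R‖u])`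
(coordinatewise). [this file] -/
theorem cthickening_image_box_subset_rows (T : E3 →L[ℝ] E3) (p : E3) (R : Fin 3 → E3)
    (hR : ∀ x i, inner ℝ (R i) (T x) = x i) (hsurj : Function.Surjective T) (l h : Fin 3 → ℝ)
    {u : ℝ} (hu : 0 ≤ u) :
    cthickening u ((fun x => p + T x) '' {x : E3 | ∀ i, l i ≤ x i ∧ x i ≤ h i}) ⊆
      (fun x => p + T x) '' {x : E3 | ∀ i, l i - ‖R i‖ * u ≤ x i ∧ x i ≤ h i + ‖R i‖ * u} := by
  refine (cthickening_image_subset_rows T p R hR hsurj (isCompact_coordBox_fin3 l h) hu).trans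
    (image_mono ?_)
  rintro z ⟨b, hb, hz⟩ i
  have h1 := hb i
  have h2 := abs_le.1 (hz i)
  constructor <;> linarith [h2.1, h2.2]

/-- ★ support (kit, the TUBE BOOK with rows): for `l ≤ h` and `0 ≤ u`,
`vol(cthickening u (p + T([l, h]))) ≤ |det T|·∏ᵢ (hᵢ - lᵢ + 2‖Rᵢ‖u)`. For a facet at relative depth `0`
(`[0,1]² × [0,0]`) this is `|det T|·(1 + 2‖R₀‖u)(1 + 2‖R₁‖u)·2‖R₂‖u`. [this file + «CollarKit» `volume_image_box`] -/
theorem volume_cthickening_image_box_le (T : E3 →L[ℝ] E3) (p : E3) (R : Fin 3 → E3)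
    (hR : ∀ x i, inner ℝ (R i) (T x) = x i) (hsurj : Function.Surjective T) (l h : Fin 3 → ℝ)
    (hlh : ∀ i, l i ≤ h i) {u : ℝ} (hu : 0 ≤ u) :
    (volume (cthickening u ((fun x => p + T x) '' {x : E3 | ∀ i, l i ≤ x i ∧ x i ≤ h i}))).toReal ≤
      |T.det| * ∏ i, (h i - l i + 2 * (‖R i‖ * u)) := by
  set l' : Fin 3 → ℝ := fun i => l i - ‖R i‖ * u
  set h' : Fin 3 → ℝ := fun i => h i + ‖R i‖ * u
  have hsub := cthickening_image_box_subset_rows T p R hR hsurj l h hu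
  have hc : IsCompact ((fun x => p + T x) '' {x : E3 | ∀ i, l' i ≤ x i ∧ x i ≤ h' i}) :=
    (isCompact_coordBox_fin3 l' h').image (by fun_prop)
  have hlh' : ∀ i, l' i ≤ h' i := fun i => by
    have := hlh i; have := mul_nonneg (norm_nonneg (R i)) hu; simp only [l', h']; linarith
  have hvol := volume_image_box T p l' h' hlh'
  have e : ∏ i, (h' i - l' i) = ∏ i, (h i - l i + 2 * (‖R i‖ * u)) :=
    Finset.prod_congr rfl fun i _ => by simp only [l', h']; ring
  rw [← e, ← hvol]
  exact ENNReal.toReal_mono hc.measure_lt_top.ne (measure_mono hsub)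

/-! ## §2 Rows under transport; the coordinate pairing -/

/-- support: dual rows transport along a linear isometry `g`: `g R` are dual rows of `g ∘ T`. -/
theorem rows_comp_isometry (g : E3 ≃ₗᵢ[ℝ] E3) {T : E3 →L[ℝ] E3} {R : Fin 3 → E3}
    (hR : ∀ x i, inner ℝ (R i) (T x) = x i) (x : E3) (i : Fin 3) :
    inner ℝ (g (R i)) ((g.toLinearIsometry.toContinuousLinearMap.comp T) x) = x i := by
  rw [ContinuousLinearMap.comp_apply, isometry_clm_apply, g.inner_map_map, hR]

/-- support: squared norms are kept by a linear isometry (rows version). -/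
theorem norm_sq_rows_comp_isometry (g : E3 ≃ₗᵢ[ℝ] E3) {R : Fin 3 → E3} {ρ : Fin 3 → ℝ}
    (hρ : ∀ i, ‖R i‖ ^ 2 = ρ i) (i : Fin 3) : ‖g (R i)‖ ^ 2 = ρ i := by
  rw [g.norm_map, hρ]

/-- The pairing of a scaled integer vector (on the left) with a vector, in coordinates. -/
theorem inner_smul_intVec_left (c : ℝ) (w : Fin 3 → ℤ) (y : E3) :
    inner ℝ (c • intVec w) y = c * ((w 0 : ℝ) * y 0 + (w 1 : ℝ) * y 1 + (w 2 : ℝ) * y 2) := by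
  rw [real_inner_comm, inner_smul_intVec_fin3]

/-- The squared norm of a scaled integer vector. -/
theorem norm_sq_smul_intVec_fin3 (c : ℝ) (w : Fin 3 → ℤ) :
    ‖c • intVec w‖ ^ 2 = c ^ 2 * ((w 0 : ℝ) ^ 2 + (w 1 : ℝ) ^ 2 + (w 2 : ℝ) ^ 2) := by
  rw [norm_smul, mul_pow, Real.norm_eq_abs, sq_abs, EuclideanSpace.norm_sq_eq, Fin.sum_univ_three]
  simp only [Real.norm_eq_abs, sq_abs, intVec_apply]

/-- TRANSPORT of a cap-in-prism package WITH ROWS along a symmetry `g` of `K`. -/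
theorem prism_rows_transport {h d β : ℝ} (hh : 0 < h) {K B : Set E3} {v : E3} {ρ : Fin 3 → ℝ}
    (g : E3 ≃ₗᵢ[ℝ] E3) (hg : ∀ x ∈ K, g.symm x ∈ K)
    (base : ∃ (p : E3) (T : E3 →L[ℝ] E3) (R : Fin 3 → E3), |T.det| = d ∧
      (∀ x, Real.sqrt 2 * h * ‖x‖ ≤ ‖T x‖) ∧ (∀ x i, inner ℝ (R i) (T x) = x i) ∧
      (∀ i, ‖R i‖ ^ 2 = ρ i) ∧ K ∩ {x | β ≤ inner ℝ x v} ⊆ (fun x => p + T x) '' B) :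
    ∃ (p : E3) (T : E3 →L[ℝ] E3) (R : Fin 3 → E3), |T.det| = d ∧
      (∀ x, Real.sqrt 2 * h * ‖x‖ ≤ ‖T x‖) ∧ Function.Surjective T ∧
      (∀ x i, inner ℝ (R i) (T x) = x i) ∧ (∀ i, ‖R i‖ ^ 2 = ρ i) ∧
      K ∩ {x | β ≤ inner ℝ x (g v)} ⊆ (fun x => p + T x) '' B := by
  obtain ⟨p, T, R, hdet, hlowT, hR, hρ, hsub⟩ := base
  have hG : ∀ u, ‖g.toLinearIsometry.toContinuousLinearMap u‖ = ‖u‖ := fun u => g.norm_map u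
  have hlow := lower_row_comp_of_norm_eq _ T hG hlowT
  refine ⟨g p, g.toLinearIsometry.toContinuousLinearMap.comp T, fun i => g (R i), ?_, hlow,
    surjective_of_lower_row _ (by positivity) hlow, rows_comp_isometry g hR,
    norm_sq_rows_comp_isometry g hρ, cap_subset_prism_transport g hg hsub⟩
  rw [abs_det_comp_of_norm_eq_left _ _ hG, hdet]

/-! ## §3 Dual rows of the base frames -/

/-- ★ DUAL ROWS of the base rhombus frame of «CellFacets» (columns `h(-1,1,1)`, `h(-1,1,-1)`, `h(1,1,0)`):
`R₀ = (-1,1,2)/(4h)`, `R₁ = (-1,1,-2)/(4h)`, `R₂ = (1,1,0)/(2h)` — the inverse coordinates of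
`rdCell_baseCap_subset_prism`; `‖R₀‖² = ‖R₁‖² = 3/(8h²)` (`1/‖R₀‖ = (2√2/√3)h` = rhombus height),
`‖R₂‖² = 1/(2h²)`. -/
theorem baseRows_spec {h : ℝ} (hh : 0 < h) :
    (∀ x i, inner ℝ (![(1 / (4 * h)) • intVec ![-1, 1, 2], (1 / (4 * h)) • intVec ![-1, 1, -2],
        (1 / (2 * h)) • intVec ![1, 1, 0]] i)
        (columnFrame (h • intVec ![-1, 1, 1]) (h • intVec ![-1, 1, -1]) (h • intVec ![1, 1, 0]) x) = x i) ∧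
      (∀ i, ‖![(1 / (4 * h)) • intVec ![-1, 1, 2], (1 / (4 * h)) • intVec ![-1, 1, -2],
        (1 / (2 * h)) • intVec ![1, 1, 0]] i‖ ^ 2 = ![3 / (8 * h ^ 2), 3 / (8 * h ^ 2), 1 / (2 * h ^ 2)] i) := by
  have h0 : h ≠ 0 := hh.ne'
  constructor
  · intro x i
    obtain ⟨e0, e1, e2⟩ := baseFrame_apply h x
    fin_cases i <;>
    · simp only [Fin.zero_eta, Fin.mk_one, Fin.reduceFinMk, Matrix.cons_val_zero, Matrix.cons_val_one,
        Matrix.cons_val_two, Matrix.head_cons, Matrix.tail_cons]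
      rw [inner_smul_intVec_left, e0, e1, e2]
      simp only [Matrix.cons_val_zero, Matrix.cons_val_one, Matrix.cons_val_two, Matrix.head_cons,
        Matrix.tail_cons, Int.cast_one, Int.cast_neg, Int.cast_ofNat, Int.cast_zero]
      field_simp
      ring
  · intro i
    fin_cases i <;>
    · simp only [Fin.zero_eta, Fin.mk_one, Fin.reduceFinMk, Matrix.cons_val_zero, Matrix.cons_val_one,
        Matrix.cons_val_two, Matrix.head_cons, Matrix.tail_cons]
      rw [norm_sq_smul_intVec_fin3]
      simp only [Matrix.cons_val_zero, Matrix.cons_val_one, Matrix.cons_val_two, Matrix.head_cons,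
        Matrix.tail_cons, Int.cast_one, Int.cast_neg, Int.cast_ofNat, Int.cast_zero]
      field_simp
      ring

/-- ★ DUAL ROWS of the equatorial frame `eqFrame h` of «CellFacetsTRD»: `R₀ = (5,5,2)/(16h)`,
`R₁ = (-1,-1,2)/(4h)`, `R₂ = (1,-1,0)/(2h)` (the inverse coordinates of `trdCell_eqCap_subset_prism`);
`‖R₀‖² = 27/(128h²)`, `‖R₁‖² = 3/(8h²)`, `‖R₂‖² = 1/(2h²)`. -/
theorem eqRows_spec {h : ℝ} (hh : 0 < h) :
    (∀ x i, inner ℝ (![(1 / (16 * h)) • intVec ![5, 5, 2], (1 / (4 * h)) • intVec ![-1, -1, 2],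
        (1 / (2 * h)) • intVec ![1, -1, 0]] i) (eqFrame h x) = x i) ∧
      (∀ i, ‖![(1 / (16 * h)) • intVec ![5, 5, 2], (1 / (4 * h)) • intVec ![-1, -1, 2],
        (1 / (2 * h)) • intVec ![1, -1, 0]] i‖ ^ 2 = ![27 / (128 * h ^ 2), 3 / (8 * h ^ 2), 1 / (2 * h ^ 2)] i) := by
  have h0 : h ≠ 0 := hh.ne'
  constructor
  · intro x i
    obtain ⟨e0, e1, e2⟩ := eqFrame_apply h x
    fin_cases i <;>
    · simp only [Fin.zero_eta, Fin.mk_one, Fin.reduceFinMk, Matrix.cons_val_zero, Matrix.cons_val_one,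
        Matrix.cons_val_two, Matrix.head_cons, Matrix.tail_cons]
      rw [inner_smul_intVec_left, e0, e1, e2]
      simp only [Matrix.cons_val_zero, Matrix.cons_val_one, Matrix.cons_val_two, Matrix.head_cons,
        Matrix.tail_cons, Int.cast_one, Int.cast_neg, Int.cast_ofNat]
      field_simp
      ring
  · intro i
    fin_cases i <;>
    · simp only [Fin.zero_eta, Fin.mk_one, Fin.reduceFinMk, Matrix.cons_val_zero, Matrix.cons_val_one,
        Matrix.cons_val_two, Matrix.head_cons, Matrix.tail_cons]
      rw [norm_sq_smul_intVec_fin3]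
      simp only [Matrix.cons_val_zero, Matrix.cons_val_one, Matrix.cons_val_two, Matrix.head_cons,
        Matrix.tail_cons, Int.cast_one, Int.cast_neg, Int.cast_ofNat, Int.cast_zero]
      field_simp
      ring

/-! ## §4 The packages with rows -/

/-- ★ «CellFacets» WITH ROWS (`k`-cell): for `0 < h`, `w ∈ fccInt` and any `ε` there are an apex `p`, a frame
`T` (`|det T| = 4h³`, lower row `√2·h`, onto) and dual rows `R` (`⟪Rᵢ, T x⟫ = xᵢ`,
`‖R‖² = (3/(8h²), 3/(8h²), 1/(2h²))`) with
`rdCell h ∩ {x | 4h²(1 - ε) ≤ ⟪x, 2h·w⟫} ⊆ p + T '' ([-ε/2, 1 + ε/2]² × [-ε, 0])`. -/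
theorem rdCell_cap_subset_prism_rows {h : ℝ} (hh : 0 < h) {w : Fin 3 → ℤ} (hw : w ∈ fccInt) (ε : ℝ) :
    ∃ (p : E3) (T : E3 →L[ℝ] E3) (R : Fin 3 → E3), |T.det| = 4 * h ^ 3 ∧
      (∀ x, Real.sqrt 2 * h * ‖x‖ ≤ ‖T x‖) ∧ Function.Surjective T ∧
      (∀ x i, inner ℝ (R i) (T x) = x i) ∧
      (∀ i, ‖R i‖ ^ 2 = ![3 / (8 * h ^ 2), 3 / (8 * h ^ 2), 1 / (2 * h ^ 2)] i) ∧
      rdCell h ∩ {x | 4 * h ^ 2 * (1 - ε) ≤ inner ℝ x ((2 * h) • intVec w)} ⊆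
        (fun x => p + T x) ''
          {x : E3 | ∀ i, ![-(ε / 2), -(ε / 2), -ε] i ≤ x i ∧ x i ≤ ![1 + ε / 2, 1 + ε / 2, 0] i} := by
  obtain ⟨g, -, hg', hgv⟩ := exists_symmetry_of_mem_fccInt h hw
  have hv : g ((2 * h) • intVec ![1, 1, 0]) = (2 * h) • intVec w := by rw [map_smul, hgv]
  rw [← hv]
  obtain ⟨hR, hρ⟩ := baseRows_spec hh
  exact prism_rows_transport hh g (fun x hx => mem_of_isInvariantUnder hg' hx)
    ⟨_, _, _, abs_det_baseFrame h hh.le, lower_row_baseFrame h hh.le, hR, hρ,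
      rdCell_baseCap_subset_prism hh ε⟩

/-- ★★ «CellFacetsHCP» WITH ROWS (`h`-cell): for `0 < h`, `ε < 1/3`, `w ∈ hcpInt` there are `p`, `T` (`|det T| =
16h³/3` on the equatorial bonds `Σw = 0`, else `4h³`; lower row `√2·h`; onto) and dual rows `R` with
`‖R₀‖² = 27/(128h²)` (equatorial) resp. `3/(8h²)`, `‖R₁‖² = 3/(8h²)`, `‖R₂‖² = 1/(2h²)`, and
`trdCell h ∩ {x | 4h²(1 - ε) ≤ ⟪x, (2h/3)·w⟫} ⊆ p + T '' ([-ε/2, 1 + ε/2]² × [-ε, 0])`. -/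
theorem trdCell_cap_subset_prism_rows {h ε : ℝ} (hh : 0 < h) (hε : ε < 1 / 3) {w : Fin 3 → ℤ}
    (hw : w ∈ hcpInt) :
    ∃ (p : E3) (T : E3 →L[ℝ] E3) (R : Fin 3 → E3),
      |T.det| = (if w 0 + w 1 + w 2 = 0 then 16 / 3 * h ^ 3 else 4 * h ^ 3) ∧
      (∀ x, Real.sqrt 2 * h * ‖x‖ ≤ ‖T x‖) ∧ Function.Surjective T ∧
      (∀ x i, inner ℝ (R i) (T x) = x i) ∧
      (∀ i, ‖R i‖ ^ 2 = (if w 0 + w 1 + w 2 = 0 then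
          ![27 / (128 * h ^ 2), 3 / (8 * h ^ 2), 1 / (2 * h ^ 2)]
        else ![3 / (8 * h ^ 2), 3 / (8 * h ^ 2), 1 / (2 * h ^ 2)]) i) ∧
      trdCell h ∩ {x | 4 * h ^ 2 * (1 - ε) ≤ inner ℝ x ((2 * h / 3) • intVec w)} ⊆
        (fun x => p + T x) ''
          {x : E3 | ∀ i, ![-(ε / 2), -(ε / 2), -ε] i ≤ x i ∧ x i ≤ ![1 + ε / 2, 1 + ε / 2, 0] i} := by
  obtain ⟨g, -, hg', hcls⟩ := exists_symmetry_of_mem_hcpInt h hw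
  have hgK : ∀ x ∈ trdCell h, g.symm x ∈ trdCell h := fun x hx => mem_of_isInvariantUnder hg' hx
  rcases hcls with ⟨hgv, hs⟩ | ⟨hgv, hs⟩ | ⟨hgv, hs⟩
  · -- equatorial class: the trapezoid in its edge parallelogram
    rw [if_pos hs, if_pos hs]
    have hv : g ((2 * h / 3) • intVec ![3, -3, 0]) = (2 * h / 3) • intVec w := by rw [map_smul, hgv]
    rw [← hv]
    obtain ⟨hR, hρ⟩ := eqRows_spec hh
    exact prism_rows_transport hh g hgK
      ⟨_, _, _, abs_det_eqFrame h hh.le, lower_row_eqFrame h hh.le, hR, hρ, trdCell_eqCap_subset_prism hh ε⟩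
  · -- upper class: the k-cell's rhombus at 2h(1,1,0)
    have hs' : ¬ (w 0 + w 1 + w 2 = 0) := by rw [hs]; norm_num
    rw [if_neg hs', if_neg hs']
    have hv : g ((2 * h / 3) • intVec ![3, 3, 0]) = (2 * h / 3) • intVec w := by rw [map_smul, hgv]
    rw [← hv]
    obtain ⟨p, T, R, hdet, hlow, -, hR, hρ, hsub⟩ :=
      rdCell_cap_subset_prism_rows hh (show ![1, 1, 0] ∈ fccInt by simp [fccInt]) ε
    exact prism_rows_transport hh g hgK ⟨p, T, R, hdet, hlow, hR, hρ, (trdCell_upCap_subset hh hε).trans hsub⟩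
  · -- lower class: the half-turn of the k-cell's rhombus at 2h(-1,-1,0)
    have hs' : ¬ (w 0 + w 1 + w 2 = 0) := by rw [hs]; norm_num
    rw [if_neg hs', if_neg hs']
    have hv : g ((2 * h / 3) • intVec ![-1, -1, -4]) = (2 * h / 3) • intVec w := by rw [map_smul, hgv]
    rw [← hv]
    obtain ⟨p, T, R, hdet, hlow, -, hR, hρ, hsub⟩ :=
      rdCell_cap_subset_prism_rows hh (show ![-1, -1, 0] ∈ fccInt by simp [fccInt]) ε
    have hH : ∀ u, ‖halfTurn.toLinearIsometry.toContinuousLinearMap u‖ = ‖u‖ :=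
      fun u => halfTurn.norm_map u
    refine prism_rows_transport hh g hgK
      ⟨halfTurn p, halfTurn.toLinearIsometry.toContinuousLinearMap.comp T, fun i => halfTurn (R i), ?_,
        lower_row_comp_of_norm_eq _ T hH hlow, rows_comp_isometry halfTurn hR,
        norm_sq_rows_comp_isometry halfTurn hρ,
        (trdCell_lowCap_subset hh hε).trans (image_subset_prism halfTurn hsub)⟩
    rw [abs_det_comp_of_norm_eq_left _ _ hH, hdet]

end

end Summit.AtomisticToContinuum.Crystallization.Theorems.OverbindingBudgetAffineFarFieldCellFacetsRows
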